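import Summits.HodgeConjecture.HodgeConjecture.Theorems.R90S7FormSignOffRam            -- ★ p861477 `R90.S7.formSignOffRam` (σ4a PAID) ⊇ ★ `F0P3XiPacketFamilyOfRecordUnram` (`ramOfRecord₂`)
import Summits.HodgeConjecture.HodgeConjecture.Theorems.F0P3KitOfRecord                 -- ★ `F0P3KitOfRecord.cptXi₀` (the compact factor `[cptXi₀ ξ]` of (14.6.3))
import Summits.HodgeConjecture.HodgeConjecture.Theorems.F0P3XiArchDataOfRecord          -- ★ `F0P3XiArchDataOfRecord.nCompactOfRecord` (`N = Card S₀`)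
import Literature.NumberTheory.Automorphic.LocalHermitianFormSign                       -- ★ `formSignAt`, `formSignAt_eq_one_or_eq_neg_one`, `formSignAt_mul_self`
import HarnessLib

/-!
# R90-TF · S7 (Ch. 14.6-tuple, C146) · FILE B `R90_S7_PKtupleSignsB` — EDITION 1 «SIGNS OF RECORD» (the witnesses `c`, `ε`, `κH` of O1″ CLOSED over the frame; row (k) PROVED)

Cell `hodgecm-mathlib`, crux H413 (`stmt-HodgeConjecture-24833`), route of record `HCCMUnconditional`; programme R90-TF (HUMAN RULING «R90-TF SLAB — MAX PUSH»,
REQUESTS l.72925), section S7 = Rogawski §14.6 (14.6.1)–(14.6.3) ∘ §13.3 Thm. 13.3.7 «the (N) tuple of O1″» (base `R90-C146`).  Typist LH7-typ1 (g2) (DEAL BY NAME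
S7-R7, S7 dealer LH7-plan (g4), R90 bus 2026-09-04T15:43:12Z); S7-audit1 = LH7-audit1 (g0) (PRE-AUDIT boxes B1–B4, R90 bus 15:41:32Z); co-typist LH7-typ2 (g0)
(file A `R90_S7_PKtupleBaseChainA`, file C); R90-TF LEAD K2E1-plan (g7).  SOCKET PLAN v1 1bf103ef2afaf2c7 §2 (σ4b, (k)); EXPORT-EDGES-S7 v2; CONSUMER-BYTES-O1″ v1
(leaf `Cruxes/H413/Lines/F0_P3c_PKtuplePaydown.lean` ED. 5 :113–:120 outer ∃ `(c : ℚ) (wXi) (jInf dsInf)`, :184 inner ∃ `(ε : OneDimAutRepH L → Places L → ℤ) (κH :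
OneDimAutRepH L → ℤ)`, :195 row (k)).  L9 (dealer): THIS FILE IMPORTS ★ `Theorems` ONLY — never file A (A ED. 3 imports B).  No socket, no `sorry`: a DEFINITIONS +
THEOREMS layer (programme LAW L8 «DEFINITIONS BEFORE SOCKETS»).

THE THREE SIGN WITNESSES OF O1″ `F0U3LettersRung1.PKtupleBaseLetterK2μ`, CLOSED OVER THE FRAME `(L, ι, H)` (+ the record's exceptional-set data for `κH`):
* (B1) **`εOfRecord L H ξ v := formSignAt L c H v`** — the local sign carried by the signed `H`-packets (PK-SHAPE-H `IsSignedXiImageOf … (ε ξ v)`: `pair ρ_v ≡ ε(ξ, v)`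
  on the members, ★ `F0P3SpectralPacketXiHSigned` §2) IS the local FORM SIGN of (KT2′) (`CharIdentityψS … (formSignAt L c H)`, T-A `TupleKitLawsK2`), i.e. print's
  local discrepancy `c_v` of (14.6.3) «`Δ′_v = c_v Δ″_v`» [§14.6 p. 242]; independent of `ξ`; no kit `pair`, no packet-sign factor (AUDIT S7#2 ∕ box B1).
* (B4) **`cOfRecord L H := ∏ᶠ_v formSignAt L c H v`** (in `ℚ`, through `cIntOfRecord` in `ℤ`) — print's frame constant «`c = ∏_v c_v = ±1`» [(14.6.3) p. 243]; a genuine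
  finite product by ★ `eventually_formSignAt_eq_one_cm`; law `c = 1 ∨ c = −1` PROVED (`finprod_induction`).  `c` is an OUTER-∃ slot of O1″ (quantified BEFORE the K9
  `∀`-prefix, leaf :118), so it must have a closed witness — no inner socket can bind it (box B4: never a lone `∃ c, c = ±1` export).
* (B2) **`κHOfRecord … ξ := [cptXi₀ ι μω ξ] · (−1)^N · c · ∏_{v ∈ ramOfRecord₂ ξ} ε(ξ, v)`** (in `ℤ`, the (k)-row's own currency) — the COMPOSITE archimedean scalar of
  ★ `F0P3SpectralPacketXiHSigned` (:16 «`κH(ξ) · ∏_{v ∈ S} ε(ξ, v)` … its identification with print's `[cptXi₀ ξ] · (−1)^N · c` is the junction's», :131 `IsSignedXiImageOf`: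
  «`κH` is NOT the bare pairing»), AUDIT S7#5 E8 σ4b [§12.3 Prop. 12.3.3 p. 178; §14.4 Prop. 14.4.2 (c) p. 236; §14.6 p. 243 l. 9 – p. 244 l. 17, p. 244 l. 5 «`N = Card(S₀)`»].
* (k) **`signProduct_of_formSignOffRam`** — ROW (k) OF O1″ AT THESE WITNESSES IS A THEOREM (box B2: not a second socket): for every finite `S ⊇ ramOfRecord₂ ξ`,
  `κH(ξ) · ∏_{v ∈ S} ε(ξ, v) = [cptXi₀ ξ] · (−1)^N · c`, because `ε² = 1` on `ramOfRecord₂ ξ` (★ `formSignAt_mul_self`) and `ε = 1` on `S ∖ ramOfRecord₂ ξ` — the latter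
  is socket σ4a «`c_v = 1` off `ramOfRecord₂ ξ`», PAID as ★ `R90.S7.formSignOffRam` (R90-C146-p01 (g0), p861477), imported BY NAME; `--axioms` TRIO.
* (B3) `wXiOfRecord` (the global root numbers `W(ξ) = ε(½, φ_ξ)`, outer-∃ slot `wXi`) is NOT in this edition: the tree has no closed root-number TERM for CM Hecke
  characters (only the predicates ★ `Rogawski1992.Sec1.RootNumberSign`, ★ `RohrlichAnticyclotomicNonvanishing.IsCentralRootNumber`), and a `Classical.choose` over
  PK-SHAPE-G's own ∃ would make its κ-scalar clause self-certifying (J2).  JQ-S7-1 (to the dealer): `wXi` gets a closed S10∕★ term, or stays ∃-bound AT OUTER LEVEL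
  together with PK-SHAPE-G's pin.

CONSUMER (file A ED. 3 composition `pkTupleBaseK2μ_of_sigmas`, LH7-typ2's pen): outer `refine ⟨cOfRecord L H, ‹wXi›, …, cOfRecord_eq_one_or_eq_neg_one L H, …⟩`; inner
`⟨…, εOfRecord L H, κHOfRecord L ι H hH′ hHd′ μω μZ keys′ hexc′, …⟩` with `hH′ := transpose_map_cmConjRingHom_eq_of_frame L ι H T hT`, `hHd′ := isUnit_det_of_frame L ι H T hT`,
`keys′ := keysOfKeysCaseTwo L μω hK μZ hquad`, `hexc′ := hexc_of_xiPinSphericalCofinite L μω hμu μZ keys′ hquad hLi` (η-reduced ξ-FAMILY); row (k) :=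
`fun ξ S hS => signProduct_of_formSignOffRam L ι H hH′ hHd′ μω μZ keys′ hquad hexc′ ξ S hS` (statement = leaf :195 with `κH ↦ κHOfRecord …`, `ε ↦ εOfRecord L H`,
`c ↦ cOfRecord L H`; the `if` is elaborated under `open scoped Classical` as at the leaf :86; `Places L` is the `abbrev` of `HeightOneSpectrum (𝓞 L⁺)`).

HONEST LABEL: a definitions layer closes nothing.  HC_CM is proved only modulo the 7 printed citations (2 remaining named inputs: hLiu418 = stmt-HodgeConjecture-24832,
h413 = stmt-HodgeConjecture-24833) — DISTANCE TO ZERO: citations 3 ∕ leaves 7 (closable 3 · S-layer 4+) ∕ axioms 0 — until rung 0 closes.  No `sorry`, no `instance`,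
no `notation`, no `axiom`, no `opaque`.
[cite: Rogawski1990, §14.6 p. 242 «c_v = 1 for almost all v», (14.6.3) p. 243 «c = ∏ c_v», p. 243 l. 9 – p. 244 l. 17, p. 244 l. 5; §12.3 Prop. 12.3.3 p. 178; §14.4 Prop. 14.4.2 (c) p. 236]
-/

set_option autoImplicit false
-- the mandated namespace repeats the single-problem summit's segment (`HodgeConjecture.HodgeConjecture`)
set_option linter.dupNamespace false

noncomputable section

open NumberField IsDedekindDomain MeasureTheory
open scoped Matrix MatrixGroups

namespace Summit.HodgeConjecture.HodgeConjecture.R90.S7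

open Literature.NumberTheory Literature.NumberTheory.Automorphic Literature.NumberTheory.Automorphic.UnitaryGroup
open Literature.NumberTheory.Rogawski1990 Literature.NumberTheory.GaloisRepresentations
open Summit.HodgeConjecture.HodgeConjecture.Cruxes.H413
open Summit.HodgeConjecture.HodgeConjecture.Cruxes.H413.F0P3XiLocalFamilyOfRecord
open Summit.HodgeConjecture.HodgeConjecture.Cruxes.H413.F0P3XiPacketFamilyOfRecord (ramOfRecord₂)

/-! ## §1 (B1) `εOfRecord` — the local signs `ε(ξ, v)` of record = the form sign `c_v` -/

/-- **(B1) `εOfRecord L H : OneDimAutRepH L → Places L⁺ → ℤ`, `ε(ξ, v) := formSignAt L c H v`** — the local sign of the signed `H`-packet `ξ_H(ρ_v)` (PK-SHAPE-H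
`IsSignedXiImageOf … (ε ξ v)`) is the FORM SIGN of the frame at `v` (= the sign of (KT2′) `CharIdentityψS … (formSignAt L c H)`), print's `c_v`; it does not depend on `ξ`.
[cite: Rogawski1990, §14.6 p. 242, (14.6.3) p. 243; §3.5 Prop. 3.5.2 (c) p. 29] -/
def εOfRecord (L : Type) [Field L] [NumberField L] [IsCMField L] (H : Matrix (Fin 3) (Fin 3) L) :
    OneDimAutRepH L → HeightOneSpectrum (𝓞 ↥(maximalRealSubfield L)) → ℤ :=
  fun _ v => formSignAt L (IsCMField.complexConj L) H v

/-- Unfolding `εOfRecord` (by `rfl`). [cite: Rogawski1990, §14.6 p. 242] -/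
theorem εOfRecord_apply (L : Type) [Field L] [NumberField L] [IsCMField L] (H : Matrix (Fin 3) (Fin 3) L) (ξ : OneDimAutRepH L)
    (v : HeightOneSpectrum (𝓞 ↥(maximalRealSubfield L))) :
    εOfRecord L H ξ v = formSignAt L (IsCMField.complexConj L) H v :=
  rfl

/-- **Law `ε(ξ, v) = ±1`.** [cite: Rogawski1990, §14.6 p. 242] -/
theorem εOfRecord_eq_one_or_eq_neg_one (L : Type) [Field L] [NumberField L] [IsCMField L] (H : Matrix (Fin 3) (Fin 3) L) (ξ : OneDimAutRepH L)
    (v : HeightOneSpectrum (𝓞 ↥(maximalRealSubfield L))) :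
    εOfRecord L H ξ v = 1 ∨ εOfRecord L H ξ v = -1 :=
  formSignAt_eq_one_or_eq_neg_one L (IsCMField.complexConj L) H v

/-- `ε(ξ, v)² = 1`. [cite: Rogawski1990, §14.6 p. 242] -/
theorem εOfRecord_mul_self (L : Type) [Field L] [NumberField L] [IsCMField L] (H : Matrix (Fin 3) (Fin 3) L) (ξ : OneDimAutRepH L)
    (v : HeightOneSpectrum (𝓞 ↥(maximalRealSubfield L))) :
    εOfRecord L H ξ v * εOfRecord L H ξ v = 1 :=
  formSignAt_mul_self L (IsCMField.complexConj L) H v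

/-- On any finite `S` the product of the SQUARED local signs is `1` (`ε² = 1`), in the (k)-row's currency `ℂ`. [cite: Rogawski1990, §14.6 p. 242] -/
theorem prod_εOfRecord_mul_prod_εOfRecord (L : Type) [Field L] [NumberField L] [IsCMField L] (H : Matrix (Fin 3) (Fin 3) L) (ξ : OneDimAutRepH L)
    (S : Finset (HeightOneSpectrum (𝓞 ↥(maximalRealSubfield L)))) :
    (∏ v ∈ S, (εOfRecord L H ξ v : ℂ)) * ∏ v ∈ S, (εOfRecord L H ξ v : ℂ) = 1 := by
  rw [← Finset.prod_mul_distrib]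
  exact Finset.prod_eq_one fun v _ => by exact_mod_cast εOfRecord_mul_self L H ξ v

/-! ## §2 (B4) `cOfRecord` — the frame constant `c = ∏_v c_v = ±1` of (14.6.3) -/

/-- **`cIntOfRecord L H : ℤ := ∏ᶠ_v formSignAt L c H v`** — print's `c = ∏_v c_v` in `ℤ`; a genuine finite product (★ `eventually_formSignAt_eq_one_cm`: `c_v = 1` for
almost all `v`). [cite: Rogawski1990, §14.6 (14.6.3) p. 243, p. 242] -/
def cIntOfRecord (L : Type) [Field L] [NumberField L] [IsCMField L] (H : Matrix (Fin 3) (Fin 3) L) : ℤ :=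
  ∏ᶠ v : HeightOneSpectrum (𝓞 ↥(maximalRealSubfield L)), formSignAt L (IsCMField.complexConj L) H v

/-- **Law `cIntOfRecord = ±1`** (a finite product of signs; `finprod_induction`). [cite: Rogawski1990, §14.6 (14.6.3) p. 243] -/
theorem cIntOfRecord_eq_one_or_eq_neg_one (L : Type) [Field L] [NumberField L] [IsCMField L] (H : Matrix (Fin 3) (Fin 3) L) :
    cIntOfRecord L H = 1 ∨ cIntOfRecord L H = -1 := by
  unfold cIntOfRecord
  refine finprod_induction (fun x : ℤ => x = 1 ∨ x = -1) (Or.inl rfl) ?_ fun v => formSignAt_eq_one_or_eq_neg_one L (IsCMField.complexConj L) H v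
  rintro x y (rfl | rfl) (rfl | rfl) <;> norm_num

/-- **(B4) `cOfRecord L H : ℚ := cIntOfRecord L H`** — the OUTER-∃ witness `c` of O1″ (leaf :118 `∃ (c : ℚ) …`), print's frame constant `c = ∏_v c_v`.
[cite: Rogawski1990, §14.6 (14.6.3) p. 243] -/
def cOfRecord (L : Type) [Field L] [NumberField L] [IsCMField L] (H : Matrix (Fin 3) (Fin 3) L) : ℚ :=
  (cIntOfRecord L H : ℚ)

/-- Unfolding `cOfRecord` (by `rfl`). [cite: Rogawski1990, §14.6 (14.6.3) p. 243] -/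
theorem cOfRecord_def (L : Type) [Field L] [NumberField L] [IsCMField L] (H : Matrix (Fin 3) (Fin 3) L) :
    cOfRecord L H = (cIntOfRecord L H : ℚ) :=
  rfl

/-- **Law `c = 1 ∨ c = −1`** — the outer clause `(c = 1 ∨ c = -1)` of O1″ (leaf :118) at the witness `cOfRecord L H`, PROVED. [cite: Rogawski1990, §14.6 (14.6.3) p. 243] -/
theorem cOfRecord_eq_one_or_eq_neg_one (L : Type) [Field L] [NumberField L] [IsCMField L] (H : Matrix (Fin 3) (Fin 3) L) :
    cOfRecord L H = 1 ∨ cOfRecord L H = -1 := by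
  unfold cOfRecord
  rcases cIntOfRecord_eq_one_or_eq_neg_one L H with h | h <;> simp [h]

/-! ## §3 (B2) `κHOfRecord` — the composite archimedean scalar `κH(ξ)` of record -/

section KappaH

variable (L : Type) [Field L] [NumberField L] [IsCMField L] (ι : L →+* ℂ) (H : Matrix (Fin 3) (Fin 3) L)
  (hH : (H.map (cmConjRingHom L))ᵀ = H) (hHd : IsUnit H.det) (μω : HeckeCharacter L)
  [∀ v : HeightOneSpectrum (𝓞 ↥(maximalRealSubfield L)), MeasurableSpace (Gqs L v ⧸ Subgroup.center (Gqs L v))]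
  (μZ : ∀ v : HeightOneSpectrum (𝓞 ↥(maximalRealSubfield L)), Measure (Gqs L v ⧸ Subgroup.center (Gqs L v)))
  (keys : ∀ (ξ : OneDimAutRepH L) (v : HeightOneSpectrum (𝓞 ↥(maximalRealSubfield L))),
    (∀ w : PlacesOver L v, IsCMField.complexConj L • w.1 = w.1) →
      {p : IrrClass (Gqs L v) × IrrClass (Gqs L v) //
        KeysCaseTwoLabels L v (μω.semilocalComponent L v) (torusLocalComponent L (IsCMField.complexConj L) v ξ.η)
          (torusLocalComponent L (IsCMField.complexConj L) v ξ.ψ) p.1 p.2 ∧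
        p.1.IsSquareIntegrable (μZ v) ∧ ¬ p.2.IsSquareIntegrable (μZ v)})
  (hquad : ∀ v : HeightOneSpectrum (𝓞 ↥(maximalRealSubfield L)), (∀ w : PlacesOver L v, IsCMField.complexConj L • w.1 = w.1) →
    IsQuadraticCharExtension (conjLocal L (IsCMField.complexConj L) v) (μω.semilocalComponent L v))
  -- the ξ-FAMILY of cofinite sphericity hypotheses (consumer: `hexc_of_xiPinSphericalCofinite L μω hμu μZ keys hquad hLi`, η-reduced)
  (hexc : ∀ ξ : OneDimAutRepH L, ∀ᶠ v : HeightOneSpectrum (𝓞 ↥(maximalRealSubfield L)) in Filter.cofinite,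
    ∀ hns : ∀ w : PlacesOver L v, IsCMField.complexConj L • w.1 = w.1,
      ((keys ξ v hns).1.2).IsSpherical (cmLocalIntegralLevel L 3 (qsForm L) v))

open scoped Classical in
/-- **(B2) `κHOfRecord … ξ := [cptXi₀ ι μω ξ] · (−1)^N · c · ∏_{v ∈ ramOfRecord₂ ξ} ε(ξ, v)`** (in `ℤ`) — the COMPOSITE archimedean scalar of the signed `H`-packet of `ξ`
(PK-SHAPE-H `IsSignedXiImageOf … (κH ξ)`: `pairInf ρ_∞ ≡ κH(ξ)` on the members; ★ `F0P3SpectralPacketXiHSigned` :131 «NOT the bare pairing: it carries the compact-place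
scalar of Prop. 14.4.2 (c) … and whatever share of the global sign»), AUDIT S7#5 E8 σ4b: the compact factor `[cptXi₀ ξ]`, the sign `(−1)^N` (`N = nCompactOfRecord L`), the
frame constant `c = cIntOfRecord L H`, and the finitely many local signs on the record's exceptional set `ramOfRecord₂ ξ` (off which `ε(ξ, v) = 1`, ★ `R90.S7.formSignOffRam`).
[cite: Rogawski1990, §12.3 Prop. 12.3.3 p. 178; §14.4 Prop. 14.4.2 (c) p. 236; §14.6 p. 243 l. 9 – p. 244 l. 17, p. 244 l. 5] -/
def κHOfRecord : OneDimAutRepH L → ℤ :=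
  fun ξ => (if F0P3KitOfRecord.cptXi₀ ι μω ξ then 1 else 0) * (-1) ^ F0P3XiArchDataOfRecord.nCompactOfRecord L * cIntOfRecord L H *
    ∏ v ∈ ramOfRecord₂ L H hH hHd μω μZ keys ξ (hexc ξ), εOfRecord L H ξ v

open scoped Classical in
/-- Unfolding `κHOfRecord` (by `rfl`). [cite: Rogawski1990, §14.6 p. 243 l. 9 – p. 244 l. 17] -/
theorem κHOfRecord_apply (ξ : OneDimAutRepH L) :
    κHOfRecord L ι H hH hHd μω μZ keys hexc ξ =
      (if F0P3KitOfRecord.cptXi₀ ι μω ξ then 1 else 0) * (-1) ^ F0P3XiArchDataOfRecord.nCompactOfRecord L * cIntOfRecord L H *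
        ∏ v ∈ ramOfRecord₂ L H hH hHd μω μZ keys ξ (hexc ξ), εOfRecord L H ξ v :=
  rfl

/-! ## §4 Row (k) of O1″ at the witnesses of record — PROVED from ★ `R90.S7.formSignOffRam` (σ4a) -/

include hquad in
/-- **`ε(ξ, v) = 1` off `ramOfRecord₂ ξ`** — socket σ4a in the `ε` currency (★ `R90.S7.formSignOffRam`, R90-C146-p01 p861477). [cite: Rogawski1990, §14.6 p. 242 «c_v = 1 for almost all v»] -/
theorem εOfRecord_eq_one_of_not_mem_ramOfRecord₂ (ξ : OneDimAutRepH L) (v : HeightOneSpectrum (𝓞 ↥(maximalRealSubfield L)))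
    (hv : v ∉ ramOfRecord₂ L H hH hHd μω μZ keys ξ (hexc ξ)) :
    εOfRecord L H ξ v = 1 :=
  formSignOffRam L H hH hHd μω μZ keys hquad ξ (hexc ξ) v hv

include hquad in
/-- On any finite `S ⊇ ramOfRecord₂ ξ` the product of the local signs is the product over `ramOfRecord₂ ξ` (the other factors are `1`).
[cite: Rogawski1990, §14.6 p. 242, p. 243 l. 9 – p. 244 l. 17] -/
theorem prod_εOfRecord_eq_prod_ramOfRecord₂ (ξ : OneDimAutRepH L) (S : Finset (HeightOneSpectrum (𝓞 ↥(maximalRealSubfield L))))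
    (hS : ramOfRecord₂ L H hH hHd μω μZ keys ξ (hexc ξ) ⊆ S) :
    ∏ v ∈ S, (εOfRecord L H ξ v : ℂ) = ∏ v ∈ ramOfRecord₂ L H hH hHd μω μZ keys ξ (hexc ξ), (εOfRecord L H ξ v : ℂ) :=
  (Finset.prod_subset hS fun v _ hv => by
    rw [εOfRecord_eq_one_of_not_mem_ramOfRecord₂ L H hH hHd μω μZ keys hquad hexc ξ v hv, Int.cast_one]).symm

include hquad in
open scoped Classical in
/-- **ROW (k) OF O1″ AT THE WITNESSES OF RECORD — «the sign bookkeeping K1∕K2∕K4»: for every finite `S ⊇ ramOfRecord₂ ξ`,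
`κH(ξ) · ∏_{v ∈ S} ε(ξ, v) = [cptXi₀ ι μω ξ] · (−1)^N · c`** (statement = leaf `F0_P3c_PKtuplePaydown` ED. 5 :195 with `κH ↦ κHOfRecord …`, `ε ↦ εOfRecord L H`,
`c ↦ cOfRecord L H`).  PROOF: `κH(ξ) = [cpt] (−1)^N c ∏_{ram} ε`, `∏_S ε = ∏_{ram} ε` (`ε = 1` off `ramOfRecord₂ ξ`: ★ `R90.S7.formSignOffRam`, σ4a PAID), and `(∏_{ram} ε)² = 1`
(★ `formSignAt_mul_self`).  This is the junction's identification «`κH(ξ) · ∏_{v ∈ S} ε(ξ, v) = [cptXi₀ ι μω ξ] · (−1)^N · c`» asked for by ★ `F0P3SpectralPacketXiHSigned` (:16, :33).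
[cite: Rogawski1990, §12.3 Prop. 12.3.3 p. 178; §14.6 (14.6.3) p. 243, p. 243 l. 9 – p. 244 l. 17, p. 244 l. 5] -/
theorem signProduct_of_formSignOffRam (ξ : OneDimAutRepH L) (S : Finset (HeightOneSpectrum (𝓞 ↥(maximalRealSubfield L))))
    (hS : ramOfRecord₂ L H hH hHd μω μZ keys ξ (hexc ξ) ⊆ S) :
    (κHOfRecord L ι H hH hHd μω μZ keys hexc ξ : ℂ) * ∏ v : ↥S, (εOfRecord L H ξ v.1 : ℂ) =
      (if F0P3KitOfRecord.cptXi₀ ι μω ξ then 1 else 0) * (-1) ^ F0P3XiArchDataOfRecord.nCompactOfRecord L * (cOfRecord L H : ℂ) := by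
  rw [Finset.prod_coe_sort S (fun v => (εOfRecord L H ξ v : ℂ)), prod_εOfRecord_eq_prod_ramOfRecord₂ L H hH hHd μω μZ keys hquad hexc ξ S hS,
    κHOfRecord_apply, cOfRecord_def, Rat.cast_intCast]
  push_cast
  rw [mul_assoc, prod_εOfRecord_mul_prod_εOfRecord L H ξ, mul_one]

end KappaH

end Summit.HodgeConjecture.HodgeConjecture.R90.S7

end
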